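import Summits.SmoothPoincare4.SmoothPoincare4.Theses.CylinderEntropy
import Summits.SmoothPoincare4.SmoothPoincare4.Theorems.CylinderEntropyCylinderRungTwoSurgeryDefs
import Summits.SmoothPoincare4.SmoothPoincare4.Theorems.CylinderEntropyCylinderRungTwoNullSurvivorsDieOfStatic
import Literature.Geometry.Riemannian.LowEntropyHypersurfacesFourNeckSurgery
import Literature.Topology.FourManifolds.NeckCapping
import Literature.Topology.FourManifolds.NonseparatingNeckSurgery
import HarnessLib

/-!
# Crux `CylinderSurgeryResolution` (stmt-SmoothPoincare4-18045, route CylinderEntropy; split piece X₁ of the deciding crux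
# `CylinderRungTwo`) — CHECKED SKELETON, line `surgery-port`

Planner (crux-strategist of stmt-SmoothPoincare4-7631, 2026-08-17).  Two registered stubs and a kernel-checked composition
concluding the route decl BY NAME.  The cut is the line lead's r17/r18 cut of `killing-flux` transported from homotopy spheres to ALL
compact connected cross-sections (the item quantifies over every topology):

* `stub_surgeryFlowOrNullAll` (XL, research — the Chodosh–Mantoulidis–Schulze genericity theorem, Thm. 1.13 with `n = 4`,
  `Λ = 4/e⁻`, and Daniels-Holgate neck surgery RE-RUN IN `N = S⁴ × ℝ` with Hamilton's monotonicity): for every compact connected `M`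
  and every thin end-separating embedding `ι : M → N`, EITHER some slice of `M` is `CylNeckSurgeryResolvable` (discards `S⁴` /
  `S³ × S¹`, finitely many smooth flows between stopping times, neck cuts, immortal thin END-SEPARATING survivors) OR a NULL SURVIVOR
  exists (a compact connected carrier of an immortal thin smooth cylinder flow whose slices never separate the ends and have zero
  vertical flux).  Same statement as the lead's `stub_cylinderSurgeryFlowOrNull` with `M ≃ₕ S⁴` replaced by `[CompactSpace M]
  [ConnectedSpace M]` — the printed mechanism never uses the homotopy type of `M`.
* `stub_nullThinStatic` (XL, flow-free degree-0 GMT) — VERBATIM the lead's registered `stub_nullThinStatic` (line `killing-flux`,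
  r18): null survivors are excluded through the LANDED glue `helper_nullSurvivorsDieOfStatic` (p141073).
* `CylinderSurgeryResolution_of : CylinderEntropy.CylinderSurgeryResolution` from the two stubs by name — sorry-free: the
  inductive predicate lies in every predicate closed under the six rules (`leastPredicate_of_resolvable`, by induction), and the
  null branch is dead.

Hardest stub: `stub_surgeryFlowOrNullAll` (research).  Disproof used: the standing `Cruxes/CylinderRungTwo/Disproof.lean` sandwich
(`exotic_of_not_cylinderRungTwo`) concerns the parent; this item is NOT implied by SPC4 (general `M`), so no `_false_without_`
obstruction of the parent transfers; `stub_nullThinStatic`'s load-bearing hypotheses (area floor / entropy gap / Willmore / flux) are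
the lead's documented witnesses (tiny spheres, two slices + necks, pillow, single slice).
-/

noncomputable section

set_option linter.dupNamespace false

open MeasureTheory Set Function
open scoped Manifold ContDiff ENNReal Topology BigOperators ContinuousMap

namespace Summit.SmoothPoincare4.SmoothPoincare4.Cruxes.CylinderSurgeryResolution.SurgeryPort

open Literature.Geometry.Riemannian
open Literature.Geometry.Lorentzian Literature.Geometry.Lorentzian.PseudoRiemannianMetric
open Literature.Geometry.Riemannian.SphericalCylinderEntropy (cylEntropy)
open Literature.Topology.FourManifolds
open Summit.SmoothPoincare4.SmoothPoincare4.Cruxes.CylinderRungTwo.KillingFlux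

/-! ## Registered stubs -/

/-- STUB 1 · **MEAN CURVATURE FLOW WITH NECK SURGERY IN THE CYLINDER, UP TO NULL SURVIVORS, FOR EVERY COMPACT CONNECTED
CROSS-SECTION** (research, XL; the lead's `stub_cylinderSurgeryFlowOrNull` with the homotopy-sphere hypothesis replaced by
compactness + connectedness).  [size XL; research-level port of two printed Euclidean programmes to `N`]
[cite: ChodoshMantoulidisSchulze2025, Thm. 1.13, Cor. 1.19, Cor. 1.22] [cite: DanielsHolgate2022, Thm. 1.3, Thm. 1.4] -/
theorem stub_surgeryFlowOrNullAll :
    ∀ (M : Type) [TopologicalSpace M] [T2Space M] [SecondCountableTopology M] [ChartedSpace (EuclideanSpace ℝ (Fin 4)) M] [IsManifold (𝓡 4) ∞ M] [CompactSpace M] [ConnectedSpace M] (ι : M → EuclideanSpace ℝ (Fin 6)), Manifold.IsSmoothEmbedding (𝓡 4) (𝓡 6) ∞ ι → (∀ x, ∑ i : Fin 5, ι x (Fin.castSucc i) ^ 2 = 1) → SeparatesEnds (Set.range ι) → cylEntropy (Set.range ι) < ENNReal.ofReal (4 / Real.exp 1) → (∃ κ : M → EuclideanSpace ℝ (Fin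 6), CylNeckSurgeryResolvable M κ) ∨ ∃ (P : Type) (_ : TopologicalSpace P) (_ : T2Space P) (_ : SecondCountableTopology P) (_ : ChartedSpace (EuclideanSpace ℝ (Fin 4)) P) (_ : IsManifold (𝓡 4) ∞ P) (_ : CompactSpace P) (_ : ConnectedSpace P) (_ : MeasurableSpace P) (_ : BorelSpace P) (F : ℝ → P → EuclideanSpace ℝ (Fin 6)) (ν : ℝ → P → EuclideanSpace ℝ (Fin 6)) (T : ℝ), IsCylinderMCF P F ν T ∧ (∀ t, T ≤ t → cylEntropy (Set.range (F t)) < 2) ∧ (∀ t, T ≤ t → ¬ SeparatesEnds (Set.range (F t))) ∧ (∀ t, T ≤ t → ∫ x, ν t x 5 ∂(Measure.comap (F t) (μH[4] : Measure (EuclideanSpace ℝ (Fin 6)))) = 0) := by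
  sorry

/-- STUB 2 · **THE STATIC DEGREE-ZERO LEMMA `NullThinStatic`** — verbatim the registered `stub_nullThinStatic` of line
`killing-flux` (lead reshape r18): no compact connected embedded NON-separating cross-section of bounded height with entropy
`≤ 2 − δ`, area at least the floor, tilt excess and Willmore energy `≤ ε` and zero vertical flux.  [size XL, flow-free GMT]
[cite: Allard1972, Thm. 6.4 and §8] [cite: Brakke1978, §4] -/
theorem stub_nullThinStatic :
    ∀ δ : ℝ, 0 < δ → ∀ B : ℝ, ∃ ε : ℝ, 0 < ε ∧
      ∀ (M : Type) [TopologicalSpace M] [T2Space M] [SecondCountableTopology M]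
        [ChartedSpace (EuclideanSpace ℝ (Fin 4)) M] [IsManifold (𝓡 4) ∞ M] [CompactSpace M]
        [ConnectedSpace M] [MeasurableSpace M] [BorelSpace M]
        (ι ν : M → EuclideanSpace ℝ (Fin 6)),
        Manifold.IsSmoothEmbedding (𝓡 4) (𝓡 6) ∞ ι →
        (∀ x, ∑ i : Fin 5, ι x (Fin.castSucc i) ^ 2 = 1) →
        ¬ SeparatesEnds (Set.range ι) →
        ∀ himm : (euclideanMetric (EuclideanSpace ℝ (Fin 6))).IsSpacelikeImmersion (𝓡 4) ι,
        (euclideanMetric (EuclideanSpace ℝ (Fin 6))).IsUnitNormal (𝓡 4) ι ν 1 →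
        (∀ x, ∑ i : Fin 5, ν x (Fin.castSucc i) * ι x (Fin.castSucc i) = 0) →
        ContMDiff (𝓡 4) (𝓡 6) ∞ ν →
        (∀ x, |ι x 5| ≤ B) →
        cylEntropy (Set.range ι) ≤ ENNReal.ofReal (2 - δ) →
        μH[4] (Metric.sphere (0 : EuclideanSpace ℝ (Fin 5)) 1) ≤ μH[4] (Set.range ι) →
        ∫⁻ x, ENNReal.ofReal (1 - ν x 5 ^ 2)
            ∂(Measure.comap ι (μH[4] : Measure (EuclideanSpace ℝ (Fin 6)))) ≤ ENNReal.ofReal ε →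
        ∫⁻ x, ENNReal.ofReal
            ((euclideanMetric (EuclideanSpace ℝ (Fin 6))).meanCurvature ι contMDiff_pullbackBilin_holds himm ν x
              ^ 2) ∂(Measure.comap ι (μH[4] : Measure (EuclideanSpace ℝ (Fin 6)))) ≤ ENNReal.ofReal ε →
        ∫ x, ν x 5 ∂(Measure.comap ι (μH[4] : Measure (EuclideanSpace ℝ (Fin 6)))) = 0 →
        False := by
  sorry

/-! ## Sorry-free composition -/

/-- A `CylNeckSurgeryResolvable` slice lies in every predicate closed under the six surgery rules (induction over the tree;
the same proof as the planner's `CylinderRungTwoSplit.leastPredicate_of_resolvable`). [folklore] -/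
theorem leastPredicate_of_resolvable {M : Type} [TopologicalSpace M] [ChartedSpace (EuclideanSpace ℝ (Fin 4)) M] {κ : M → EuclideanSpace ℝ (Fin 6)}
    (h : CylNeckSurgeryResolvable M κ) :
    haveI : Fact (Module.finrank ℝ (EuclideanSpace ℝ (Fin 4)) = 3 + 1) := ⟨finrank_euclideanSpace_fin⟩; letI g := Literature.Geometry.Riemannian.euclideanMetric (EuclideanSpace ℝ (Fin 6)); ∀ Q : (∀ (P : Type) [TopologicalSpace P] [ChartedSpace (EuclideanSpace ℝ (Fin 4)) P], (P → EuclideanSpace ℝ (Fin 6)) → Prop), (∀ (P : Type) [TopologicalSpace P] [ChartedSpace (EuclideanSpace ℝ (Fin 4)) P], Literature.Geometry.Riemannian.IsMCFDiscardedComponent P → ∀ κ' : P → EuclideanSpace ℝ (Fin 6), Q P κ') → (∀ (P : Type) [TopologicalSpace P] [T2Space P] [ChartedSpace (EuclideanSpace ℝ (Fin 4)) P] [IsManifold (𝓡 4) ∞ P] (F ν : ℝ → P → EuclideanSpace ℝ (Fin 6)) (T₀ T₁ : ℝ), T₀ < T₁ → (∃ U : Set ℝ, IsOpen U ∧ Set.Icc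 T₀ T₁ ⊆ U ∧ ContMDiffOn (𝓘(ℝ, ℝ).prod (𝓡 4)) (𝓡 6) ∞ (fun q : ℝ × P => F q.1 q.2) (U ×ˢ Set.univ)) → (∀ t ∈ Set.Icc T₀ T₁, Manifold.IsSmoothEmbedding (𝓡 4) (𝓡 6) ∞ (F t)) → (∀ t ∈ Set.Icc T₀ T₁, ∀ x, ∑ i : Fin 5, F t x (Fin.castSucc i) ^ 2 = 1) → ∀ hi : (∀ t ∈ Set.Icc T₀ T₁, g.IsSpacelikeImmersion (𝓡 4) (F t)), (∀ t ∈ Set.Icc T₀ T₁, g.IsUnitNormal (𝓡 4) (F t) (ν t) 1) → (∀ t ∈ Set.Icc T₀ T₁, ∀ x, ∑ i : Fin 5, ν t x (Fin.castSucc i) * F t x (Fin.castSucc i) = 0) → (∀ t ∈ Set.Icc T₀ T₁, ContMDiff (𝓡 4) (𝓡 6) ∞ (ν t)) → (∀ t (ht : t ∈ Set.Icc T₀ T₁) (x : P), mfderiv 𝓘(ℝ, ℝ) (𝓡 6) (fun s => F s x) t (1 : ℝ) = -(g.meanCurvature (F t) Literature.Geometry.Lorentzian.PseudoRiemannianMetric.contMDiff_pullbackBilin_holds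 (hi t ht) (ν t) x) • ν t x) → Q P (F T₁) → Q P (F T₀)) → (∀ (P P' : Type) [TopologicalSpace P] [ChartedSpace (EuclideanSpace ℝ (Fin 4)) P] [TopologicalSpace P'] [ChartedSpace (EuclideanSpace ℝ (Fin 4)) P'] [IsManifold (𝓡 4) ∞ P'] (κ' : P → EuclideanSpace ℝ (Fin 6)) (e : P ≃ₘ⟮𝓡 4, 𝓡 4⟯ P'), Q P κ' → Q P' (κ' ∘ e.symm)) → (∀ (P : Type) [TopologicalSpace P] [T2Space P] [ChartedSpace (EuclideanSpace ℝ (Fin 4)) P] [IsManifold (𝓡 4) ∞ P] (κ' : P → EuclideanSpace ℝ (Fin 6)) (ψ : (Metric.sphere (0 : EuclideanSpace ℝ (Fin 4)) 1) × ℝ → P) (D₁ : Literature.Topology.FourManifolds.NeckCapData 3 ψ) (D₂ : Literature.Topology.FourManifolds.NeckCapData 3 (fun q => ψ (q.1, -q.2))), Disjoint (D₁.side : Set P) D₂.side → (∀ p : P, p ∉ D₁.side → p ∉ D₂.side → ∃ θ, ψ (θ, 0) = p) → ∀ (κ₁ : D₁.Capped → EuclideanSpace ℝ (Fin 6)) (κ₂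 : D₂.Capped → EuclideanSpace ℝ (Fin 6)), Q D₁.Capped κ₁ → Q D₂.Capped κ₂ → Q P κ') → (∀ (P : Type) [TopologicalSpace P] [T2Space P] [ChartedSpace (EuclideanSpace ℝ (Fin 4)) P] [IsManifold (𝓡 4) ∞ P] (κ' : P → EuclideanSpace ℝ (Fin 6)) (ψ : (Metric.sphere (0 : EuclideanSpace ℝ (Fin 4)) 1) × ℝ → P) (hψ : Manifold.IsSmoothEmbedding ((𝓡 3).prod 𝓘(ℝ, ℝ)) (𝓡 4) ∞ ψ) (ho : IsOpen (Set.range ψ)), IsPreconnected (ψ '' (Set.univ ×ˢ ({0} : Set ℝ)))ᶜ → ∀ μ : Literature.Topology.FourManifolds.DoubleCap.M hψ ho → EuclideanSpace ℝ (Fin 6), Q (Literature.Topology.FourManifolds.DoubleCap.M hψ ho) μ → Q P κ') → (∀ (P : Type) [TopologicalSpace P] [T2Space P] [SecondCountableTopology P] [ChartedSpace (EuclideanSpace ℝ (Fin 4)) P] [IsManifold (𝓡 4) ∞ P] [CompactSpace P] [ConnectedSpace P] (F ν : ℝ → P → EuclideanSpace ℝ (Fin 6)) (T : ℝ), Summit.SmoothPoincare4.SmoothPoincare4.Cruxes.CylinderRungTwo.KillingFlux.IsCylinderMCF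 P F ν T → (∀ t, T ≤ t → Summit.SmoothPoincare4.SmoothPoincare4.Cruxes.CylinderRungTwo.KillingFlux.SeparatesEnds (Set.range (F t))) → (∀ t, T ≤ t → Literature.Geometry.Riemannian.SphericalCylinderEntropy.cylEntropy (Set.range (F t)) < 2) → Q P (F T)) → Q M κ := by
  intro Q h1 h2 h3 h4 h5 h6
  induction h with
  | discard hM κ => exact h1 _ hM κ
  | flow hT hF h ih =>
    exact h2 _ _ _ _ _ hT hF.contMDiffOn hF.isSmoothEmbedding hF.mem_cyl hF.isSpacelikeImmersion hF.isUnitNormal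
      hF.normal_tangent hF.contMDiff_normal hF.velocity_eq ih
  | of_diffeomorph h e ih => exact h3 _ _ _ e ih
  | cut κ D₁ D₂ hdisj hcover κ₁ κ₂ h₁ h₂ ih₁ ih₂ => exact h4 _ κ _ D₁ D₂ hdisj hcover κ₁ κ₂ ih₁ ih₂
  | cutNonseparating κ hψ hψo hns κ' h ih => exact h5 _ κ _ hψ hψo hns κ' ih
  | immortal hF hsep hthin => exact h6 _ _ _ _ hF hsep hthin

/-- **THE COMPOSITION `CylinderEntropy.CylinderSurgeryResolution` from the two registered stubs BY NAME** (route decl; its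
`haveI`/`letI` prefixes are inlined by the renderer, so after `intro` the goal is the least-predicate statement): the null branch of
`stub_surgeryFlowOrNullAll` is excluded by the landed `helper_nullSurvivorsDieOfStatic stub_nullThinStatic`, the resolvable branch lies
in every rule-closed predicate by `leastPredicate_of_resolvable`. [folklore] -/
theorem CylinderSurgeryResolution_of :
    Summit.SmoothPoincare4.SmoothPoincare4.Theses.CylinderEntropy.CylinderSurgeryResolution := by
  intro M _ _ _ _ _ _ _ ι hι hN hsep hent
  rcases stub_surgeryFlowOrNullAll M ι hι hN hsep hent with ⟨κ, hκ⟩ | hnull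
  · exact ⟨κ, leastPredicate_of_resolvable hκ⟩
  · exact absurd hnull (helper_nullSurvivorsDieOfStatic stub_nullThinStatic)

end Summit.SmoothPoincare4.SmoothPoincare4.Cruxes.CylinderSurgeryResolution.SurgeryPort

end
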